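import Summits.QuantumFields.BalabanUV.Beta.GAN24.ThreeLegFreezeBricks

/-!
# `BalabanUV.Beta.GAN24.ThreeLegDoubleFreeze` — binder row G-an2-4 ∕ (CONV-C), W-slot, the (α-0) parity re-cut, located crux (Q-L-k₀)
# (RULING R-gan24p1-g35-1 (2)(b2), amended by leaf-01 g74's COUNT C-leaf01-g74-1, journal l.53136): **THE THREE-LEG CORE — DOUBLE FIRST-MOMENT
# FREEZING** (part 2 of 3; part 1 = `GAN24/ThreeLegFreezeBricks`, part 3 = `GAN24/ThreeLegDoubleFreezeSummable`).  Scalar lattice analysis (no kernels, no fibres): the push of a `LocStencil₂`-decaying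
# four-index table `W v v′ x p` through two block-smooth SLOT legs `h₁ v`, `h₂ v′` and one KERNEL leg `ρ x`, the position `p` block-summed over one
# `L`-block, is bounded by `a_ρ·(e^{κ₀}Zl(δ/6))·(a′²·C·e^{2κ₀}·M² + 2·a·a′·g·e^{κ₀}·M + a²·g)·L^{d+1}·Zl(κ₀/(2(d+1)))·e^{−(κ₀/6)·spread}` — TWO Lipschitz
# allowances `a′` against the table's constant `C`; the sup allowances `a` only against the SLOT CHARGES `g` of the table.

NOT IN PRINT; OUR PROOF ([folklore] real analysis; 0 `def`, 0 cited facts, 0 `def … : Prop`, 0 sorry, 0 wall binders).  HONEST FRAMING (cell contract,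
verbatim): «discharging `BetaPertH` makes Bałaban's UV stability UNCONDITIONAL — a real constructive-QFT result; it is NOT the continuum limit and NOT
the Clay problem.»  HONEST DEPENDENCY (verbatim): «continuum YM on T⁴ ⇐ BetaPertH ∧ nine spine estimates (0/9 proved); BetaPertH ⇐ (D1) ∧ (D4) ∧
CAP+tail; G-an2-4 gates asym, D1 and NE2/3/4.»

## Why (COUNT C-leaf01-g74-1, `HOME/b2b-balaban-gan24-formalise-leaf-01/g74/COUNT-QLk0-threeleg.md`)
The window hypothesis (H1♮) of leaf-03's (Q-L) socket (`LegLetterRowsOfLegChain`, `LegRowsOnRuledClass`) asks that the k₀-fold leg chain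
`legChain kc K♮ᴱ Lc n k₀ ∘ bsumPow Lc k₀` map `LocStencil₂ W C δ ∧ GoodL W g` to `LocStencil₂ · (θ·C + Cg·g) δ`, `θ < 1`.  After nesting, one output entry
is `(Π kc)·Σ'_x R(x)·Σ'_v H(v)·Σ'_{v′} H′(v′)·Σ_{p ∈ B_L(y)} W(v,v′,x,p)` with composite legs of relative blocking `L = Lc^{k₀}` carrying leaf-12's envelopes
(sup `a = Cr·(L^{d+2})⁻¹`, unit gradient `a′ = Cr′·(L^{d+3})⁻¹`) and `Π|kc| ≤ L^{3(d+1)}` under the pin.  The naive count is `L^{d−2}` (relevant at `d = 3`),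
position-neutrality gives `L^{d−3}` (marginal), and a dipole letter in the ruled class shows no further GoodL-free gain.  What DOES gain is SLOT NEUTRALITY:
anchoring BOTH slot legs at the kernel leg's own fine site `x` (the outermost variable of `legStep`'s order x ▸ v ▸ v′ ▸ p — so ONE product-dominated
Fubini suffices), `H(v)H′(v′) = [H(v) − H(x)]·[H′(v′) − H′(x)] + H(x)·[H′(v′) − H′(x)] + [H(v) − H(x)]·H′(x) + H(x)H′(x)`; the last three pair with the slot
charges `Σ'_{v′} W`, `Σ'_v W`, `Σ'_vΣ'_{v′} W` only, and the double difference costs `a′²` — `L^{d−4}` after the scalar, contracting at `d = 3`.  THIS FILE is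
that estimate for ONE entry, in `EnvelopeBlockSum.tsum_env4_le`'s currency (so the packaging into `LocStencil₂` is `Push4Irr` §C verbatim, at rate
`κ₀/(6(d+1)) ≥ δ` once `δ ≤ κ₀/(6(d+1))` — NO loss of the table's rate, see part 1's header).

## What is proved (generic `d`; under part 1's standing hypotheses)
* summabilities; the two slot legs frozen at the kernel site (`abs_h₁_sub_le`, `abs_h₂_sub_le`: part 1's `abs_sub_le_transfer` at rate `δ/6`); `tsum_boxW_eq`, **`inner_layer`** (the second slot frozen at `x`: `Σ'_{v′} h₂·wb = Σ'_{v′}(h₂ − h₂ x)·wb + h₂ x·Σ_tΣ'_{v′} W`, remainder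
  `≤ (a′e^{κ₀}E_{c₂}(x))·(C e^{κ₀}Zl(δ/6)E_{c₄}(x) e^{−(δ/3)|v−x|₁})·M`, `M = (2/(δ/6))·Zl(δ/12)`);
* **`tsum_tsum_frozen_comm`** (the ONE Fubini, `KernelWard.tsum_comm_of_prodBound`: the frozen inner layer summed over the first slot first gives the
  block-summed first-slot charges);
* **`abs_slotLayers_le`** (both slot layers at a fixed kernel site: `≤ (e^{κ₀}Zl(δ/6))·(a′²·C·e^{2κ₀}·M² + 2·a·a′·g·e^{κ₀}·M + a²·g)·E_{c₁}E_{c₂}E_{c₄}(x)`);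
* **`abs_threeLeg_blockSum_le`** — THE CORE, one output entry: `|Σ'_x ρ x·Σ'_v h₁ v·Σ'_{v′} h₂ v′·Σ_{t ∈ box L} W v v′ x (L•c₄ + t)| ≤ a_ρ·(…)·L^{d+1}·
  Zl(κ₀/(2(d+1)))·e^{−(κ₀/6)(‖c₂−c₁‖∞+‖c₃−c₁‖∞+‖c₄−c₁‖∞)}`.
(Part 3 `GAN24/ThreeLegDoubleFreezeSummable`: the summability of the two outer layers and the `LocStencil₂` packaging, for the carrier.)
THIS IS NOT (H1♮): the carrier (`legChain` of `legStep`s = ONE push through the composite legs), the dressing of the legs (`legAct_legChain_respStepBm`,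
by parts onto `divW` ∕ `ldiv` — COUNT (v-b)), the slot charges from the slot divergences (by parts) and the fibre sums are other files; discharges NOTHING of
(Q-L) ∕ (C) ∕ «T2Shape» ∕ «T2Drift» ∕ (hW, hWall); NEVER «G-an2-4 closed» as (CONV-C); NOT D1, NOT `BetaPertH`, NOT continuum, NOT Clay; not in print.
Unit `b2b-balaban-gan24-formalise-leaf-01` (G-an2-4 formalisation swarm, leaf prover 01, gen 74), 2026-08-23.
-/

noncomputable section

open Finset
open scoped BigOperators
open Literature.MathematicalPhysics.QuantumFieldTheory.LatticeForm (quo)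
open Literature.MathematicalPhysics.QuantumFieldTheory.Balaban1983to89
open Literature.MathematicalPhysics.QuantumFieldTheory.Balaban1983to89.Beta
open B4ContourShift (supNorm abs_le_supNorm supNorm_nonneg exists_supNorm_eq)
open B4Reflection242 (supNorm_le_of_forall supNorm_add_le)
open B12Sec2to5 (l1 l1_nonneg)
open ExpKernelCalculus (Zl Zl_nonneg Zl_pos summable_exp_shift summable_exp_shift' tsum_exp_shift tsum_exp_shift' l1_sub_triangle l1_sub_symm)
open AffineAveraging (box toSite)
open KKTFluctuationEnergy (quo_zsmul_add_toSite)
open KernelWard (ProdBound tsum_comm_of_prodBound)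
open Summit.QuantumFields.BalabanUV.Beta.GAN24.LatticeFreeze (mul_exp_neg_le abs_sub_le_of_unit_steps)
open Summit.QuantumFields.BalabanUV.Beta.GAN24.EnvelopeBlockSum (env_le_one summable_env tsum_env4_le)
open Summit.QuantumFields.BalabanUV.Beta.GAN24.ThreeLegFreezeBricks

namespace Summit.QuantumFields.BalabanUV.Beta.GAN24.ThreeLegDoubleFreeze

variable {d : ℕ}

/-! ## §4 The layers and the core (one output entry) -/

section Core

variable {L : ℕ} {κ₀ δ a a' aρ C g : ℝ} {h₁ h₂ ρ : (Fin (d + 1) → ℤ) → ℝ}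
  {W : (Fin (d + 1) → ℤ) → (Fin (d + 1) → ℤ) → (Fin (d + 1) → ℤ) → (Fin (d + 1) → ℤ) → ℝ}
  {c₁ c₂ c₃ c₄ : Fin (d + 1) → ℤ}
  (hL : 1 ≤ L) (hκ : 0 < κ₀) (hδ : 0 < δ) (hgap : κ₀ ≤ δ / 6 * L)
  (ha : 0 ≤ a) (ha' : 0 ≤ a') (haρ : 0 ≤ aρ) (hC : 0 ≤ C) (hg : 0 ≤ g)
  (hh₁ : ∀ v, |h₁ v| ≤ a * Real.exp (-(κ₀ * supNorm (quo L v - c₁))))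
  (hh₁' : ∀ v i, |h₁ (v + Pi.single i 1) - h₁ v| ≤ a' * Real.exp (-(κ₀ * supNorm (quo L v - c₁))))
  (hh₂ : ∀ v, |h₂ v| ≤ a * Real.exp (-(κ₀ * supNorm (quo L v - c₂))))
  (hh₂' : ∀ v i, |h₂ (v + Pi.single i 1) - h₂ v| ≤ a' * Real.exp (-(κ₀ * supNorm (quo L v - c₂))))
  (hρ : ∀ x, |ρ x| ≤ aρ * Real.exp (-(κ₀ * supNorm (quo L x - c₃))))
  (hW : ∀ v v' x p, |W v v' x p| ≤ C * Real.exp (-δ * l1 (v' - v)) * Real.exp (-δ * (l1 (x - v) + l1 (p - v))))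
  (hq₂ : ∀ v x p, |∑' v', W v v' x p| ≤ g * Real.exp (-δ * (l1 (x - v) + l1 (p - v))))
  (hq₁ : ∀ v' x p, |∑' v, W v v' x p| ≤ g * Real.exp (-δ * (l1 (x - v') + l1 (p - v'))))
  (hq₁₂ : ∀ x p, |∑' v, ∑' v', W v v' x p| ≤ g * Real.exp (-δ * l1 (p - x)))

/-! ### Summabilities and the Lipschitz transfers of the two slot legs -/

include hδ hW in
/-- [folklore] The table is summable in its second slot. -/
theorem summable_W_snd (v x p : Fin (d + 1) → ℤ) : Summable fun v' => W v v' x p := by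
  refine Summable.of_norm_bounded ((summable_exp_shift' hδ v).mul_left (C * Real.exp (-δ * (l1 (x - v) + l1 (p - v))))) fun v' => ?_
  rw [Real.norm_eq_abs]
  refine (hW v v' x p).trans (le_of_eq ?_)
  ring

include hδ hC hW in
/-- [folklore] The table is summable in its first slot. -/
theorem summable_W_fst (v' x p : Fin (d + 1) → ℤ) : Summable fun v => W v v' x p := by
  refine Summable.of_norm_bounded ((summable_exp_shift' hδ v').mul_left C) fun v => ?_
  rw [Real.norm_eq_abs]
  refine (hW v v' x p).trans ?_
  have h1 : Real.exp (-δ * (l1 (x - v) + l1 (p - v))) ≤ 1 := by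
    rw [Real.exp_le_one_iff]; have := l1_nonneg (x - v); have := l1_nonneg (p - v); nlinarith
  rw [l1_sub_symm v' v]
  calc C * Real.exp (-δ * l1 (v - v')) * Real.exp (-δ * (l1 (x - v) + l1 (p - v)))
      ≤ C * Real.exp (-δ * l1 (v - v')) * 1 := by gcongr
    _ = _ := by ring

include hδ hg hq₂ in
/-- [folklore] The second-slot charge is summable in the first slot. -/
theorem summable_q₂ (x p : Fin (d + 1) → ℤ) : Summable fun v => ∑' v', W v v' x p := by
  refine Summable.of_norm_bounded ((summable_exp_shift' hδ x).mul_left g) fun v => ?_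
  rw [Real.norm_eq_abs]
  refine (hq₂ v x p).trans ?_
  refine mul_le_mul_of_nonneg_left ?_ hg
  rw [Real.exp_le_exp, l1_sub_symm v x]
  have := l1_nonneg (p - v); have := l1_nonneg (x - v)
  nlinarith


include hL hκ hgap ha' hh₁' in
/-- [folklore] The first slot leg, frozen at the kernel site: `|h₁ v − h₁ x| ≤ (a′·e^{κ₀}·E_{c₁}(x))·|v−x|₁·e^{(δ/6)|v−x|₁}`. -/
theorem abs_h₁_sub_le (x v : Fin (d + 1) → ℤ) :
    |h₁ v - h₁ x| ≤ (a' * Real.exp κ₀ * Real.exp (-(κ₀ * supNorm (quo L x - c₁)))) * l1 (v - x) * Real.exp (δ / 6 * l1 (v - x)) :=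
  abs_sub_le_transfer hL hκ.le (rate_gap (δ := δ) hL hgap) ha' c₁ hh₁' x v

include hL hκ hgap ha' hh₂' in
/-- [folklore] The second slot leg, frozen at the kernel site. -/
theorem abs_h₂_sub_le (x v' : Fin (d + 1) → ℤ) :
    |h₂ v' - h₂ x| ≤ (a' * Real.exp κ₀ * Real.exp (-(κ₀ * supNorm (quo L x - c₂)))) * l1 (v' - x) * Real.exp (δ / 6 * l1 (v' - x)) :=
  abs_sub_le_transfer hL hκ.le (rate_gap (δ := δ) hL hgap) ha' c₂ hh₂' x v'

/-! ### The inner layer (second slot) -/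

include hδ hW in
/-- [folklore] `Σ'_{v′}` of the block-summed table is the block sum of the second-slot charges. -/
theorem tsum_boxW_eq (v x : Fin (d + 1) → ℤ) :
    ∑' v', ∑ t ∈ box (d + 1) L, W v v' x ((L : ℤ) • c₄ + toSite t)
      = ∑ t ∈ box (d + 1) L, ∑' v', W v v' x ((L : ℤ) • c₄ + toSite t) :=
  Summable.tsum_finsetSum fun _ _ => summable_W_snd hδ hW v x _

include hL hκ hδ hgap ha ha' hC hh₂ hh₂' hW in
/-- [folklore] **THE INNER LAYER, FROZEN AT THE KERNEL SITE**: with `wb v′ := Σ_t W v v′ x p_t`,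
`Σ'_{v′} h₂ v′·wb v′ = Σ'_{v′} (h₂ v′ − h₂ x)·wb v′ + h₂ x·Σ_t Σ'_{v′} W v v′ x p_t` (both series summable), and the first-moment remainder obeys
`|Σ'_{v′} (h₂ v′ − h₂ x)·wb v′| ≤ (a′e^{κ₀}E_{c₂}(x))·(C·e^{κ₀}·Zl(δ/6)·E_{c₄}(x)·e^{−(δ/3)|v−x|₁})·M`, `M = (2/(δ/6))·Zl(δ/12)`. -/
theorem inner_layer (v x : Fin (d + 1) → ℤ) :
    (Summable fun v' => h₂ v' * ∑ t ∈ box (d + 1) L, W v v' x ((L : ℤ) • c₄ + toSite t)) ∧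
    (Summable fun v' => (h₂ v' - h₂ x) * ∑ t ∈ box (d + 1) L, W v v' x ((L : ℤ) • c₄ + toSite t)) ∧
    (∑' v', h₂ v' * ∑ t ∈ box (d + 1) L, W v v' x ((L : ℤ) • c₄ + toSite t)
      = (∑' v', (h₂ v' - h₂ x) * ∑ t ∈ box (d + 1) L, W v v' x ((L : ℤ) • c₄ + toSite t))
        + h₂ x * ∑ t ∈ box (d + 1) L, ∑' v', W v v' x ((L : ℤ) • c₄ + toSite t)) ∧
    |∑' v', (h₂ v' - h₂ x) * ∑ t ∈ box (d + 1) L, W v v' x ((L : ℤ) • c₄ + toSite t)|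
      ≤ (a' * Real.exp κ₀ * Real.exp (-(κ₀ * supNorm (quo L x - c₂)))) *
          ((C * Real.exp κ₀ * Zl (d + 1) (δ / 6) * Real.exp (-(κ₀ * supNorm (quo L x - c₄)))) * Real.exp (-(δ / 3) * l1 (v - x))) *
          (2 / (δ / 6) * Zl (d + 1) (δ / 6 / 2)) := by
  have hwb : ∀ v', |∑ t ∈ box (d + 1) L, W v v' x ((L : ℤ) • c₄ + toSite t)|
      ≤ ((C * Real.exp κ₀ * Zl (d + 1) (δ / 6) * Real.exp (-(κ₀ * supNorm (quo L x - c₄)))) * Real.exp (-(δ / 3) * l1 (v - x))) *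
          Real.exp (-(δ / 3) * l1 (v' - x)) := fun v' => abs_boxW_le hL hκ hδ hgap hC hW v v' x
  have hδ3 : 0 < δ / 3 := by positivity
  -- (1) summability of `h₂ · wb` (sup × decay)
  have hsup : ∀ v', |h₂ v'| ≤ a := fun v' => (hh₂ v').trans (by nlinarith [env_le_one (L := L) hκ.le c₂ v'])
  have hS1 := (abs_tsum_sup_mul_le (u := x) hδ3 ha hsup hwb).1
  -- (2) the first-moment remainder (moment × decay)
  have hmom := abs_tsum_moment_mul_le (u := x) (κ := δ / 6) (δ' := δ / 3) (by linarith) (by positivity)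
    (abs_h₂_sub_le hL hκ hgap ha' hh₂' x) hwb
  rw [show δ / 3 - δ / 6 = δ / 6 by ring] at hmom
  refine ⟨hS1, hmom.1, ?_, hmom.2⟩
  -- (3) the split
  have hSw : Summable fun v' => ∑ t ∈ box (d + 1) L, W v v' x ((L : ℤ) • c₄ + toSite t) :=
    summable_sum fun t _ => summable_W_snd hδ hW v x _
  rw [← tsum_boxW_eq hδ hW v x, ← tsum_mul_left, ← hmom.1.tsum_add (hSw.mul_left (h₂ x))]
  exact tsum_congr fun v' => by ring


/-! ### The one Fubini: the first-slot charge enters after the inner freezing -/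

include hL hκ hδ hgap ha' hC hh₂' hW in
/-- [folklore] **THE ONE PRODUCT-DOMINATED INTERCHANGE** (`KernelWard.tsum_comm_of_prodBound`): summing the frozen inner layer over the FIRST slot first
produces the block-summed first-slot charges — `Σ'_v Σ'_{v′} (h₂ v′ − h₂ x)·wb v v′ = Σ'_{v′} (h₂ v′ − h₂ x)·Σ_t Σ'_v W v v′ x p_t`. -/
theorem tsum_tsum_frozen_comm (x : Fin (d + 1) → ℤ) :
    ∑' v, ∑' v', (h₂ v' - h₂ x) * ∑ t ∈ box (d + 1) L, W v v' x ((L : ℤ) • c₄ + toSite t)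
      = ∑' v', (h₂ v' - h₂ x) * ∑ t ∈ box (d + 1) L, ∑' v, W v v' x ((L : ℤ) • c₄ + toSite t) := by
  have hδ3 : 0 < δ / 3 := by positivity
  set B₀ : ℝ := C * Real.exp κ₀ * Zl (d + 1) (δ / 6) * Real.exp (-(κ₀ * supNorm (quo L x - c₄))) with hB₀
  set γ₂ : ℝ := a' * Real.exp κ₀ * Real.exp (-(κ₀ * supNorm (quo L x - c₂))) with hγ₂
  have hB₀0 : 0 ≤ B₀ := by rw [hB₀]; have := Zl_nonneg (D := d + 1) (show 0 < δ / 6 by positivity); positivity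
  have hγ₂0 : 0 ≤ γ₂ := by rw [hγ₂]; positivity
  have hwb : ∀ v v', |∑ t ∈ box (d + 1) L, W v v' x ((L : ℤ) • c₄ + toSite t)|
      ≤ (B₀ * Real.exp (-(δ / 3) * l1 (v - x))) * Real.exp (-(δ / 3) * l1 (v' - x)) := fun v v' => by
    rw [hB₀]; exact abs_boxW_le hL hκ hδ hgap hC hW v v' x
  have hlip : ∀ v', |h₂ v' - h₂ x| ≤ γ₂ * l1 (v' - x) * Real.exp (δ / 6 * l1 (v' - x)) := fun v' => by
    rw [hγ₂]; exact abs_h₂_sub_le hL hκ hgap ha' hh₂' x v'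
  -- the product majorant
  have hPB : ProdBound (fun v v' => (h₂ v' - h₂ x) * ∑ t ∈ box (d + 1) L, W v v' x ((L : ℤ) • c₄ + toSite t)) := by
    refine ⟨fun v => B₀ * Real.exp (-(δ / 3) * l1 (v - x)),
      fun v' => (γ₂ * l1 (v' - x) * Real.exp (δ / 6 * l1 (v' - x))) * Real.exp (-(δ / 3) * l1 (v' - x)),
      (summable_exp_shift' hδ3 x).mul_left B₀, ?_, fun v => by positivity,
      fun v' => by have := l1_nonneg (v' - x); positivity, fun v v' => ?_⟩
    · exact (abs_tsum_moment_mul_le (u := x) (κ := δ / 6) (δ' := δ / 3) (B := 1) (by linarith) hγ₂0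
        (ψ := fun v' => γ₂ * l1 (v' - x) * Real.exp (δ / 6 * l1 (v' - x)))
        (fun v' => by rw [abs_of_nonneg (by have := l1_nonneg (v' - x); positivity)])
        (fun v' => by rw [one_mul, abs_of_pos (Real.exp_pos _)])).1
    · rw [abs_mul]
      calc |h₂ v' - h₂ x| * |∑ t ∈ box (d + 1) L, W v v' x ((L : ℤ) • c₄ + toSite t)|
          ≤ (γ₂ * l1 (v' - x) * Real.exp (δ / 6 * l1 (v' - x))) * ((B₀ * Real.exp (-(δ / 3) * l1 (v - x))) * Real.exp (-(δ / 3) * l1 (v' - x))) :=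
            mul_le_mul (hlip v') (hwb v v') (abs_nonneg _) (by have := l1_nonneg (v' - x); positivity)
        _ = _ := by ring
  rw [tsum_comm_of_prodBound hPB]
  refine tsum_congr fun v' => ?_
  rw [tsum_mul_left, Summable.tsum_finsetSum fun _ _ => summable_W_fst hδ hC hW v' x _]

/-! ### The outer layer (first slot) and the kernel site: one output entry -/

include hL hκ hδ hgap ha ha' hC hg hh₁ hh₁' hh₂ hh₂' hW hq₂ hq₁ hq₁₂ in
/-- [folklore] **THE TWO SLOT LAYERS AT A FIXED KERNEL SITE `x`** — double first-moment freezing: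
`|Σ'_v h₁ v·Σ'_{v′} h₂ v′·Σ_t W v v′ x p_t| ≤ (e^{κ₀}·Zl(δ/6))·(a′²·C·e^{2κ₀}·M² + 2·a·a′·g·e^{κ₀}·M + a²·g)·E_{c₁}(x)·E_{c₂}(x)·E_{c₄}(x)`, `M = (2/(δ/6))·Zl(δ/12)`:
the table's constant `C` meets TWO Lipschitz allowances, the sup allowances meet only the slot charges `g`. -/
theorem abs_slotLayers_le (x : Fin (d + 1) → ℤ) :
    |∑' v, h₁ v * ∑' v', h₂ v' * ∑ t ∈ box (d + 1) L, W v v' x ((L : ℤ) • c₄ + toSite t)|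
      ≤ (Real.exp κ₀ * Zl (d + 1) (δ / 6)) *
          (a' ^ 2 * C * Real.exp κ₀ ^ 2 * (2 / (δ / 6) * Zl (d + 1) (δ / 6 / 2)) ^ 2
            + 2 * (a * a' * g * Real.exp κ₀ * (2 / (δ / 6) * Zl (d + 1) (δ / 6 / 2))) + a ^ 2 * g) *
          (Real.exp (-(κ₀ * supNorm (quo L x - c₁))) * Real.exp (-(κ₀ * supNorm (quo L x - c₂))) *
            Real.exp (-(κ₀ * supNorm (quo L x - c₄)))) := by
  have hδ3 : 0 < δ / 3 := by positivity
  have hZ := Zl_nonneg (D := d + 1) (show 0 < δ / 6 by positivity)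
  have hZ' := Zl_nonneg (D := d + 1) (show 0 < δ / 6 / 2 by positivity)
  -- names
  set E₁ : ℝ := Real.exp (-(κ₀ * supNorm (quo L x - c₁))) with hE₁
  set E₂ : ℝ := Real.exp (-(κ₀ * supNorm (quo L x - c₂))) with hE₂
  set E₄ : ℝ := Real.exp (-(κ₀ * supNorm (quo L x - c₄))) with hE₄
  set M : ℝ := 2 / (δ / 6) * Zl (d + 1) (δ / 6 / 2) with hM
  set B₀ : ℝ := C * Real.exp κ₀ * Zl (d + 1) (δ / 6) * E₄ with hB₀
  set G₀ : ℝ := g * Real.exp κ₀ * Zl (d + 1) (δ / 6) * E₄ with hG₀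
  set γ₁ : ℝ := a' * Real.exp κ₀ * E₁ with hγ₁
  set γ₂ : ℝ := a' * Real.exp κ₀ * E₂ with hγ₂
  have hM0 : 0 ≤ M := by rw [hM]; positivity
  have hB₀0 : 0 ≤ B₀ := by rw [hB₀]; positivity
  have hG₀0 : 0 ≤ G₀ := by rw [hG₀]; positivity
  have hγ₁0 : 0 ≤ γ₁ := by rw [hγ₁]; positivity
  have hγ₂0 : 0 ≤ γ₂ := by rw [hγ₂]; positivity
  set wb : (Fin (d + 1) → ℤ) → (Fin (d + 1) → ℤ) → ℝ := fun v v' => ∑ t ∈ box (d + 1) L, W v v' x ((L : ℤ) • c₄ + toSite t) with hwb_def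
  set ID : (Fin (d + 1) → ℤ) → ℝ := fun v => ∑' v', (h₂ v' - h₂ x) * wb v v' with hID_def
  set Q₂ : (Fin (d + 1) → ℤ) → ℝ := fun v => ∑ t ∈ box (d + 1) L, ∑' v', W v v' x ((L : ℤ) • c₄ + toSite t) with hQ₂_def
  set Q₁ : (Fin (d + 1) → ℤ) → ℝ := fun v' => ∑ t ∈ box (d + 1) L, ∑' v, W v v' x ((L : ℤ) • c₄ + toSite t) with hQ₁_def
  -- the bricks
  have hI : ∀ v, ∑' v', h₂ v' * wb v v' = ID v + h₂ x * Q₂ v := fun v => (inner_layer (c₄ := c₄) hL hκ hδ hgap ha ha' hC hh₂ hh₂' hW v x).2.2.1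
  have hID : ∀ v, |ID v| ≤ (γ₂ * B₀ * M) * Real.exp (-(δ / 3) * l1 (v - x)) := fun v => by
    have h := (inner_layer (c₄ := c₄) hL hκ hδ hgap ha ha' hC hh₂ hh₂' hW v x).2.2.2
    rw [hγ₂, hB₀, hM, hE₂, hE₄]
    refine h.trans (le_of_eq ?_); ring
  have hQ₂ : ∀ v, |Q₂ v| ≤ G₀ * Real.exp (-(δ / 3) * l1 (v - x)) := fun v => by
    rw [hG₀, hE₄]; exact abs_boxq₂_le (c₄ := c₄) hL hκ hδ hgap hg hq₂ v x
  have hQ₁ : ∀ v', |Q₁ v'| ≤ G₀ * Real.exp (-(δ / 3) * l1 (v' - x)) := fun v' => by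
    rw [hG₀, hE₄]; exact abs_boxq₁_le (c₄ := c₄) hL hκ hδ hgap hg hq₁ v' x
  have hQ₁₂ : |∑ t ∈ box (d + 1) L, ∑' v, ∑' v', W v v' x ((L : ℤ) • c₄ + toSite t)| ≤ G₀ := by
    rw [hG₀, hE₄]; exact abs_boxq₁₂_le (c₄ := c₄) hL hκ hδ hgap hg hq₁₂ x
  have h1x : |h₁ x| ≤ a * E₁ := hh₁ x
  have h2x : |h₂ x| ≤ a * E₂ := hh₂ x
  have hsup₁ : ∀ v, |h₁ v| ≤ a := fun v => (hh₁ v).trans (by nlinarith [env_le_one (L := L) hκ.le c₁ v])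
  have hlip₁ : ∀ v, |h₁ v - h₁ x| ≤ γ₁ * l1 (v - x) * Real.exp (δ / 6 * l1 (v - x)) := fun v => by
    rw [hγ₁]; exact abs_h₁_sub_le hL hκ hgap ha' hh₁' x v
  have hlip₂ : ∀ v', |h₂ v' - h₂ x| ≤ γ₂ * l1 (v' - x) * Real.exp (δ / 6 * l1 (v' - x)) := fun v' => by
    rw [hγ₂]; exact abs_h₂_sub_le hL hκ hgap ha' hh₂' x v'
  -- Step A: split the outer layer along `I = ID + h₂ x · Q₂`
  have hSA := abs_tsum_sup_mul_le (u := x) hδ3 ha hsup₁ hID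
  have hSB := abs_tsum_sup_mul_le (u := x) hδ3 ha hsup₁ hQ₂
  have eJ : (∑' v, h₁ v * ∑' v', h₂ v' * wb v v') = (∑' v, h₁ v * ID v) + h₂ x * ∑' v, h₁ v * Q₂ v := by
    rw [← tsum_mul_left, ← hSA.1.tsum_add (hSB.1.mul_left (h₂ x))]
    exact tsum_congr fun v => by rw [hI v]; ring
  -- Step B: the `ID` series — MAIN (moment × decay) plus `h₁ x · Σ' ID` (Fubini, then moment × decay)
  have hmomB := abs_tsum_moment_mul_le (u := x) (κ := δ / 6) (δ' := δ / 3) (by linarith) hγ₁0 hlip₁ hID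
  rw [show δ / 3 - δ / 6 = δ / 6 by ring] at hmomB
  have eB : (∑' v, h₁ v * ID v) = (∑' v, (h₁ v - h₁ x) * ID v) + h₁ x * ∑' v, ID v := by
    have hSID : Summable ID := by
      have := (abs_tsum_sup_mul_le (u := x) (ψ := fun _ => (1 : ℝ)) hδ3 zero_le_one (fun _ => by simp) hID).1
      simpa using this
    rw [← tsum_mul_left, ← hmomB.1.tsum_add (hSID.mul_left (h₁ x))]
    exact tsum_congr fun v => by ring
  have eFub : (∑' v, ID v) = ∑' v', (h₂ v' - h₂ x) * Q₁ v' := tsum_tsum_frozen_comm (c₄ := c₄) hL hκ hδ hgap ha' hC hh₂' hW x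
  have hmomF := abs_tsum_moment_mul_le (u := x) (κ := δ / 6) (δ' := δ / 3) (by linarith) hγ₂0 hlip₂ hQ₁
  rw [show δ / 3 - δ / 6 = δ / 6 by ring] at hmomF
  -- Step C: the `Q₂` series — moment × decay plus `h₁ x · Q₁₂`
  have hmomC := abs_tsum_moment_mul_le (u := x) (κ := δ / 6) (δ' := δ / 3) (by linarith) hγ₁0 hlip₁ hQ₂
  rw [show δ / 3 - δ / 6 = δ / 6 by ring] at hmomC
  have eC : (∑' v, h₁ v * Q₂ v) = (∑' v, (h₁ v - h₁ x) * Q₂ v) + h₁ x * ∑ t ∈ box (d + 1) L, ∑' v, ∑' v', W v v' x ((L : ℤ) • c₄ + toSite t) := by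
    have hSQ : Summable Q₂ := summable_sum fun t _ => summable_q₂ hδ hg hq₂ x _
    have eQ : (∑' v, Q₂ v) = ∑ t ∈ box (d + 1) L, ∑' v, ∑' v', W v v' x ((L : ℤ) • c₄ + toSite t) :=
      Summable.tsum_finsetSum fun _ _ => summable_q₂ hδ hg hq₂ x _
    rw [← eQ, ← tsum_mul_left, ← hmomC.1.tsum_add (hSQ.mul_left (h₁ x))]
    exact tsum_congr fun v => by ring
  -- Step D: assemble
  rw [eJ, eB, eFub, eC]
  have hE₁0 : 0 ≤ E₁ := (Real.exp_pos _).le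
  have hE₂0 : 0 ≤ E₂ := (Real.exp_pos _).le
  have t1 := hmomB.2
  have t2 : |h₁ x * ∑' v', (h₂ v' - h₂ x) * Q₁ v'| ≤ (a * E₁) * (γ₂ * G₀ * M) := by
    rw [abs_mul]; exact mul_le_mul h1x (by rw [hM]; exact hmomF.2) (abs_nonneg _) (by positivity)
  have t3 : |∑' v, (h₁ v - h₁ x) * Q₂ v| ≤ γ₁ * G₀ * M := by rw [hM]; exact hmomC.2
  have t4 : |h₁ x * ∑ t ∈ box (d + 1) L, ∑' v, ∑' v', W v v' x ((L : ℤ) • c₄ + toSite t)| ≤ (a * E₁) * G₀ := by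
    rw [abs_mul]; exact mul_le_mul h1x hQ₁₂ (abs_nonneg _) (by positivity)
  have t34 : |h₂ x * ((∑' v, (h₁ v - h₁ x) * Q₂ v) + h₁ x * ∑ t ∈ box (d + 1) L, ∑' v, ∑' v', W v v' x ((L : ℤ) • c₄ + toSite t))|
      ≤ (a * E₂) * (γ₁ * G₀ * M + (a * E₁) * G₀) := by
    rw [abs_mul]
    exact mul_le_mul h2x ((abs_add_le _ _).trans (add_le_add t3 t4)) (abs_nonneg _) (by positivity)
  calc |(∑' v, (h₁ v - h₁ x) * ID v) + h₁ x * ∑' v', (h₂ v' - h₂ x) * Q₁ v'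
        + h₂ x * ((∑' v, (h₁ v - h₁ x) * Q₂ v) + h₁ x * ∑ t ∈ box (d + 1) L, ∑' v, ∑' v', W v v' x ((L : ℤ) • c₄ + toSite t))|
      ≤ |(∑' v, (h₁ v - h₁ x) * ID v) + h₁ x * ∑' v', (h₂ v' - h₂ x) * Q₁ v'|
        + |h₂ x * ((∑' v, (h₁ v - h₁ x) * Q₂ v) + h₁ x * ∑ t ∈ box (d + 1) L, ∑' v, ∑' v', W v v' x ((L : ℤ) • c₄ + toSite t))| :=
        abs_add_le _ _
    _ ≤ (γ₁ * (γ₂ * B₀ * M) * (2 / (δ / 6) * Zl (d + 1) (δ / 6 / 2)) + (a * E₁) * (γ₂ * G₀ * M))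
        + (a * E₂) * (γ₁ * G₀ * M + (a * E₁) * G₀) :=
        add_le_add ((abs_add_le _ _).trans (add_le_add t1 t2)) t34
    _ = _ := by rw [hγ₁, hγ₂, hB₀, hG₀, hM]; ring


include hL hκ hδ hgap ha ha' haρ hC hg hh₁ hh₁' hh₂ hh₂' hρ hW hq₂ hq₁ hq₁₂ in
/-- NOT IN PRINT; OUR PROOF.  **THE THREE-LEG CORE — DOUBLE FIRST-MOMENT FREEZING, ONE OUTPUT ENTRY** (COUNT C-leaf01-g74-1 (iv)).  Two block-smooth SLOT
legs `h₁`, `h₂` (sup `a·E_{c₁}`, `a·E_{c₂}`, unit gradient `a′·E`), one KERNEL leg `ρ` (sup `a_ρ·E_{c₃}`), `E_c(v) = e^{−κ₀‖quo L v − c‖∞}`, a table with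
`|W v v′ x p| ≤ C·e^{−δ|v′−v|₁}·e^{−δ(|x−v|₁+|p−v|₁)}` whose SLOT CHARGES are bounded by `g` (second slot `Σ'_{v′}`, first slot `Σ'_v`, both), the position
`p` summed over the `L`-block labelled `c₄`; rates `0 < δ`, `0 < κ₀ ≤ (δ/6)·L`.  THEN
`|Σ'_x ρ x·Σ'_v h₁ v·Σ'_{v′} h₂ v′·Σ_{t ∈ box L} W v v′ x (L•c₄ + t)| ≤ a_ρ·(e^{κ₀}·Zl(δ/6))·(a′²·C·e^{2κ₀}·M² + 2·a·a′·g·e^{κ₀}·M + a²·g)·L^{d+1}·Zl(κ₀/(2(d+1)))·e^{−(κ₀/6)(‖c₂−c₁‖∞+‖c₃−c₁‖∞+‖c₄−c₁‖∞)}`,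
`M = (2/(δ/6))·Zl(δ/12)` — `EnvelopeBlockSum.tsum_env4_le`'s currency (so `Push4Irr` §C packages it into `LocStencil₂` at rate `κ₀/(6(d+1))`, which is
`≥ δ` as soon as `δ ≤ κ₀/(6(d+1))`: NO loss of the table's rate).  The table's constant `C` meets `a′²` (two relative powers `L⁻¹` in leaf-12's currency
`a′ = Cr′·(L^{d+3})⁻¹` versus `a = Cr·(L^{d+2})⁻¹`); the sup allowances meet only the slot charges. -/
theorem abs_threeLeg_blockSum_le :
    |∑' x, ρ x * ∑' v, h₁ v * ∑' v', h₂ v' * ∑ t ∈ box (d + 1) L, W v v' x ((L : ℤ) • c₄ + toSite t)|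
      ≤ aρ * ((Real.exp κ₀ * Zl (d + 1) (δ / 6)) *
          (a' ^ 2 * C * Real.exp κ₀ ^ 2 * (2 / (δ / 6) * Zl (d + 1) (δ / 6 / 2)) ^ 2
            + 2 * (a * a' * g * Real.exp κ₀ * (2 / (δ / 6) * Zl (d + 1) (δ / 6 / 2))) + a ^ 2 * g)) *
        ((L : ℝ) ^ (d + 1) * Zl (d + 1) (κ₀ / (2 * ((d : ℝ) + 1))) *
          Real.exp (-(κ₀ / 6) * (supNorm (c₂ - c₁) + supNorm (c₃ - c₁) + supNorm (c₄ - c₁)))) := by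
  have hZ := Zl_nonneg (D := d + 1) (show 0 < δ / 6 by positivity)
  have hZ' := Zl_nonneg (D := d + 1) (show 0 < δ / 6 / 2 by positivity)
  set Jc : ℝ := (Real.exp κ₀ * Zl (d + 1) (δ / 6)) *
      (a' ^ 2 * C * Real.exp κ₀ ^ 2 * (2 / (δ / 6) * Zl (d + 1) (δ / 6 / 2)) ^ 2
        + 2 * (a * a' * g * Real.exp κ₀ * (2 / (δ / 6) * Zl (d + 1) (δ / 6 / 2))) + a ^ 2 * g) with hJc
  have hJc0 : 0 ≤ Jc := by rw [hJc]; positivity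
  have hE4 := tsum_env4_le (d := d) hL hκ c₁ c₂ c₃ c₄
  have hpt : ∀ x, ‖ρ x * ∑' v, h₁ v * ∑' v', h₂ v' * ∑ t ∈ box (d + 1) L, W v v' x ((L : ℤ) • c₄ + toSite t)‖
      ≤ (aρ * Jc) * (Real.exp (-(κ₀ * supNorm (quo L x - c₁))) * Real.exp (-(κ₀ * supNorm (quo L x - c₂))) *
          Real.exp (-(κ₀ * supNorm (quo L x - c₃))) * Real.exp (-(κ₀ * supNorm (quo L x - c₄)))) := fun x => by
    rw [Real.norm_eq_abs, abs_mul]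
    have hJ := abs_slotLayers_le (c₄ := c₄) hL hκ hδ hgap ha ha' hC hg hh₁ hh₁' hh₂ hh₂' hW hq₂ hq₁ hq₁₂ x
    rw [← hJc] at hJ
    calc |ρ x| * |∑' v, h₁ v * ∑' v', h₂ v' * ∑ t ∈ box (d + 1) L, W v v' x ((L : ℤ) • c₄ + toSite t)|
        ≤ (aρ * Real.exp (-(κ₀ * supNorm (quo L x - c₃)))) * (Jc * (Real.exp (-(κ₀ * supNorm (quo L x - c₁))) *
            Real.exp (-(κ₀ * supNorm (quo L x - c₂))) * Real.exp (-(κ₀ * supNorm (quo L x - c₄))))) :=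
          mul_le_mul (hρ x) hJ (abs_nonneg _) (by positivity)
      _ = _ := by ring
  have hs := hE4.1.mul_left (aρ * Jc)
  have hb := tsum_of_norm_bounded hs.hasSum hpt
  rw [Real.norm_eq_abs, tsum_mul_left] at hb
  exact hb.trans (mul_le_mul_of_nonneg_left hE4.2 (by positivity))

end Core

end Summit.QuantumFields.BalabanUV.Beta.GAN24.ThreeLegDoubleFreeze

end
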